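import Literature.NumberTheory.ConnesMoscovici2022.UVProlateSymmetryReduction
import Literature.NumberTheory.ConnesMoscovici2022.UVProlateVonNeumann
import HarnessLib

/-!
# Connes–Moscovici 2022, §1: the boundary condition (1.19) holds on `dom W_min`

LINE 1 — FRAMING. RH-FREE corpus literature (cell rh-crit, C1 Connes–Consani/Moscovici corpus,
row O2 `UVProlateSpectrum`: the self-adjointness theory of the prolate wave operator
`W_λ = −∂ₓ(λ² − x²)∂ₓ + (2πλx)²`; sequel material with no leaf / binder role in any route).
bears_on: LADDER-RH W-C/W-P.  WHAT THIS IS NOT: any claim about `ζ` or RH; nothing here bears on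
the truth of RH.  Theorems only: 0 public `def`s, 0 named facts, no `sorry`.

## Source and purpose

A. Connes, H. Moscovici, *The UV prolate spectrum matches the zeros of zeta*, PNAS 119 (2022)
[ConnesMoscovici2022] = arXiv:2112.05500, §1 (= arXiv §2): Lemma 1.2 (iv) ("the restriction of
`L` to `Dom W_min` vanishes"), the Green computation in the proof of Lemma 1.3, and the definition
of `dom W_sa` by the boundary conditions (1.19)–(1.21) (held text `paper-arxiv-2112.05500`, chunk
p0004:L88–L120, p0006:L52–L69).

The self-adjointness half of [ConnesMoscovici2022, Thm 1.6 (i)] via von Neumann theory (seat cc-t11,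
`UVProlateThm16Assembly.isSelfAdjoint_prolateSA_of_minDomain_le_of_independent`) needs
`hmin : dom W_min ⊆ 𝓛_β`, i.e. every element of the minimal domain satisfies the boundary
conditions.  This file proves the `±λ` part, (1.19): for `ξ ∈ dom W_min` and its regular
representative `g` (seat cc-t6, `exists_regular_repr`), ALL FOUR one-sided limits of
`(λ² − x²) g′(x)` at `±λ` are `0`.

Why not Lemma 1.2 as typed (`CM22_lemma_1_2`): its clause (v) identifies `L(ξ)` with a
TWO-sided limit within `ℝ ∖ {±λ}`, which a general regular representative is not known to have
a priori.  Road taken instead (one side at a time, from (1.4)–(1.6)):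

* §1 `indicator_mem_prolateMax` — TEST ELEMENTS: for `χ ∈ C²(ℝ)` and `a < b` with
  `p(e)χ(e) = p(e)χ′(e) = 0` at both endpoints, `1_{(a,b)} χ ∈ dom W_max` with
  `W_max (1_{(a,b)} χ) = 1_{(a,b)} (−(pχ′)′ + qχ)` (Green against Schwartz functions via
  `exists_prolateMax_eq_of_forall_integral`; the jump at a singular endpoint is killed by
  `p(±λ) = 0`).  (Seat cc-t8's `exists_prolateMax_indicator_mul` is the special case
  `(a, b) = (−λ, λ)`; here one-sided outer cut-offs are needed as well.)
* §2 `tendsto_pDeriv_nhdsGT_zero_of_inner_symm` / `…nhdsLT…` — ENGINE: if `ξ ∈ dom W_max` is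
  `W_max`-symmetric against every `ζ ∈ dom W_max` and `(a, a + r] ⊂ ℝ ∖ {±λ}` with `p(a) = 0`, then
  `p g′ → 0` at `a⁺`: testing against `ζ = 1_{(a,a+r)} χ` (`χ` a bump `= 1` near `a`) gives
  `∫_a^{a+r} (conj η·χ − conj g·Wχ) = 0`, while Lagrange's identity
  (`intervalIntegral_lagrange_pair`, seat cc-t6) evaluates `∫_s^{a+r}(…) = conj (p g′)(s)` for `s`
  near `a`, and the left side is continuous in `s`.
* §3 `tendsto_pDeriv_zero_of_mem_prolateMin` (the four one-sided limits),
  `tendsto_pDeriv_nhdsWithin_zero_of_mem_prolateMin` (the `𝓝[ℝ ∖ {±λ}] (±λ)` form used by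
  `ProlateBC.atLam/atNegLam`) — for `ξ ∈ dom W_min`, symmetric by
  `inner_prolateMax_comm_of_mem_prolateMin_left` (seat cc-t11).

The `±∞` conditions (1.20)/(1.21) on `dom W_min` (same engine against `cutoff·sin(2πλx)/x`,
`cutoff·cos(2πλx)/x`, with `UVProlateMaxDomainAsymptotics` §4) are the sequel
`UVProlateMinDomainAtInfinity`.  Cell rh-crit seat cc-t14 g3.
-/

noncomputable section

open Complex Set MeasureTheory Filter Topology intervalIntegral Metric
open scoped Real Topology ContDiff InnerProductSpace ComplexConjugate SchwartzMap

namespace Literature.NumberTheory.ConnesMoscovici2022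

open Literature.NumberTheory.ConnesConsani2021 Literature.NumberTheory.ConnesConsani2024

variable {lam : ℝ}

/-! ## §0. Private helpers -/

/-- `p′ = −2x`. [folklore] -/
private theorem hasDerivAt_pCoeff₃ (lam x : ℝ) :
    HasDerivAt (pCoeff lam) (((-(2 * x) : ℝ) : ℂ)) x := by
  have h : HasDerivAt (fun y : ℝ ↦ lam ^ 2 - y ^ 2) (-(2 * x)) x := by
    simpa using (hasDerivAt_pow 2 x).const_sub (lam ^ 2)
  have e : pCoeff lam = fun y : ℝ ↦ (((lam ^ 2 - y ^ 2 : ℝ)) : ℂ) := rfl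
  rw [e]
  exact h.ofReal_comp

/-- `p` is continuous. [folklore] -/
private theorem continuous_pCoeff₃ (lam : ℝ) : Continuous (pCoeff lam) := by
  have e : pCoeff lam = fun y : ℝ ↦ (((lam ^ 2 - y ^ 2 : ℝ)) : ℂ) := rfl
  rw [e]; fun_prop

/-- `q` is continuous. [folklore] -/
private theorem continuous_qCoeff₃ (lam : ℝ) : Continuous (qCoeff lam) := by
  have e : qCoeff lam = fun y : ℝ ↦ ((((2 * π * lam) ^ 2 * y ^ 2 : ℝ)) : ℂ) := rfl
  rw [e]; fun_prop

/-- `star p = p`. [folklore] -/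
private theorem star_pCoeff₃ (lam x : ℝ) : star (pCoeff lam x) = pCoeff lam x := by
  rw [pCoeff]; exact Complex.conj_ofReal _

/-- `ℝ ∖ {±λ}` is open. [folklore] -/
private theorem isOpen_S₃ (lam : ℝ) : IsOpen {x : ℝ | x ≠ lam ∧ x ≠ -lam} :=
  isOpen_ne.and isOpen_ne

/-- A representative of an `L²` class is integrable on bounded intervals. [folklore] -/
private theorem intervalIntegrable_repr₃ (ξ : L2R) {g : ℝ → ℂ} (hae : ((ξ : ℝ → ℂ)) =ᵐ[volume] g)
    (x y : ℝ) : IntervalIntegrable g volume x y := by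
  have hloc : LocallyIntegrable (fun t ↦ ((ξ : L2R) : ℝ → ℂ) t) :=
    (Lp.memLp (ξ : L2R)).locallyIntegrable (by norm_num)
  have h1 : IntegrableOn (fun t ↦ ((ξ : L2R) : ℝ → ℂ) t) (uIcc x y) :=
    hloc.integrableOn_isCompact isCompact_uIcc
  exact (h1.congr_fun_ae (ae_restrict_of_ae hae)).intervalIntegrable

/-- Conjugation preserves interval integrability. [folklore] -/
private theorem intervalIntegrable_star₃ {f : ℝ → ℂ} {x y : ℝ} (hf : IntervalIntegrable f volume x y) :
    IntervalIntegrable (fun t ↦ star (f t)) volume x y := by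
  constructor
  · exact (Complex.conjCLE : ℂ →L[ℝ] ℂ).integrable_comp hf.1
  · exact (Complex.conjCLE : ℂ →L[ℝ] ℂ).integrable_comp hf.2

/-- A continuous function cut off to a bounded interval is in `L²`. [folklore] -/
private theorem memLp_indicator_Ioo {φ : ℝ → ℂ} (hφ : Continuous φ) (a b : ℝ) :
    MemLp ((Ioo a b).indicator φ) 2 volume := by
  obtain ⟨C, hC⟩ := isCompact_Icc.exists_bound_of_continuousOn (hφ.continuousOn (s := Icc a b))
  have hmeas : AEStronglyMeasurable ((Ioo a b).indicator φ) volume :=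
    hφ.aestronglyMeasurable.indicator measurableSet_Ioo
  have htop : MemLp ((Ioo a b).indicator φ) ⊤ volume := by
    refine memLp_top_of_bound hmeas (max C 0) (Eventually.of_forall fun x ↦ ?_)
    by_cases hx : x ∈ Ioo a b
    · rw [indicator_of_mem hx]
      exact (hC x (Ioo_subset_Icc_self hx)).trans (le_max_left _ _)
    · rw [indicator_of_notMem hx, norm_zero]; exact le_max_right _ _
  refine htop.mono_exponent_of_measure_support_ne_top (s := Ioo a b)
    (fun x hx ↦ indicator_of_notMem hx _) ?_ le_top
  rw [Real.volume_Ioo]; exact ENNReal.ofReal_ne_top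

/-! ## §1. Test elements: a smooth function cut off to an interval with harmless endpoints -/

section TestElement

/-- **Cut-off smooth functions are in `dom W_max`.**  Let `χ ∈ C²(ℝ)` and `a < b` be such that at
each endpoint `e ∈ {a, b}` the Green boundary term is harmless: `p(e) χ(e) = 0` and
`p(e) χ′(e) = 0` (so either `e = ±λ` is a singular point, where `p(e) = 0`, or `χ` vanishes to first
order at `e`).  Then the `L²` class of `1_{(a,b)} χ` belongs to `dom W_max`, with
`W_max (1_{(a,b)} χ) = 1_{(a,b)} (−(p χ′)′ + q χ)`: for every Schwartz `θ`, Green's formula on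
`[a, b]` gives `∫_a^b ((Wθ) χ − θ (Wχ)) = [θ·(p χ′) − p θ′·χ]_a^b = 0`.  (These are the elements
"`P_λ f`" and their outer analogues used as test vectors in the proofs of Lemma 1.3 and Thm 1.6.)
[cite: ConnesMoscovici2022, proof of Lemma 1.3 (= arXiv:2112.05500 Lemma 2.3, chunk p0004:L110–L120, p0005:L1–L9)] -/
theorem indicator_mem_prolateMax (lam : ℝ) {a b : ℝ} (hab : a < b) {χ : ℝ → ℂ}
    (hχ : ContDiff ℝ 2 χ)
    (ha : pCoeff lam a * χ a = 0 ∧ pCoeff lam a * deriv χ a = 0)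
    (hb : pCoeff lam b * χ b = 0 ∧ pCoeff lam b * deriv χ b = 0) :
    ∃ (hG : MemLp ((Ioo a b).indicator χ) 2 volume)
      (hH : MemLp ((Ioo a b).indicator
        (fun t ↦ -deriv (fun s ↦ pCoeff lam s * deriv χ s) t + qCoeff lam t * χ t)) 2 volume)
      (hdom : hG.toLp _ ∈ (prolateMax lam).domain),
      prolateMax lam ⟨hG.toLp _, hdom⟩ = hH.toLp _ := by
  -- `χ ∈ C²`: derivative bookkeeping
  have h2 : ContDiff ℝ (1 + 1) χ := by simpa [one_add_one_eq_two] using hχ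
  have hχd : Differentiable ℝ χ := (contDiff_succ_iff_deriv.mp h2).1
  have hχ'1 : ContDiff ℝ 1 (deriv χ) := (contDiff_succ_iff_deriv.mp h2).2.2
  have hχ'd : Differentiable ℝ (deriv χ) := hχ'1.differentiable one_ne_zero
  have hχ''c : Continuous (deriv (deriv χ)) := hχ'1.continuous_deriv le_rfl
  have hχ1 : ContDiff ℝ 1 χ := hχ.of_le (by norm_num)
  set u : ℝ → ℂ := fun s ↦ pCoeff lam s * deriv χ s with hu
  have hud : ∀ s, HasDerivAt u
      (((-(2 * s) : ℝ) : ℂ) * deriv χ s + pCoeff lam s * deriv (deriv χ) s) s := fun s ↦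
    (hasDerivAt_pCoeff₃ lam s).mul (hχ'd s).hasDerivAt
  have hu' : deriv u = fun s ↦ ((-(2 * s) : ℝ) : ℂ) * deriv χ s + pCoeff lam s * deriv (deriv χ) s :=
    funext fun s ↦ (hud s).deriv
  have hu'c : Continuous (deriv u) := by
    rw [hu']
    exact ((Complex.continuous_ofReal.comp (by fun_prop)).mul hχ'1.continuous).add
      ((continuous_pCoeff₃ lam).mul hχ''c)
  set Wχ : ℝ → ℂ := fun t ↦ -deriv (fun s ↦ pCoeff lam s * deriv χ s) t + qCoeff lam t * χ t
    with hWχ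
  have hWχc : Continuous Wχ := hu'c.neg.add ((continuous_qCoeff₃ lam).mul hχ.continuous)
  have hG : MemLp ((Ioo a b).indicator χ) 2 volume := memLp_indicator_Ioo hχ.continuous a b
  have hH : MemLp ((Ioo a b).indicator Wχ) 2 volume := memLp_indicator_Ioo hWχc a b
  refine ⟨hG, hH, ?_⟩
  -- the weak equation against Schwartz functions
  have hweak : ∀ θ : 𝓢(ℝ, ℂ),
      ∫ x, prolateSchwartz lam θ x * (hG.toLp _ : L2R) x = ∫ x, θ x * (hH.toLp _ : L2R) x := by
    intro θ
    have hθ2 : ContDiff ℝ 2 θ := θ.smooth 2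
    -- both sides are interval integrals over `[a, b]`
    have h1 : ∫ x, prolateSchwartz lam θ x * (hG.toLp _ : L2R) x =
        ∫ x in a..b, prolateSchwartz lam θ x * χ x := by
      have e1 : (fun x ↦ prolateSchwartz lam θ x * (hG.toLp _ : L2R) x) =ᵐ[volume]
          (Ioo a b).indicator (fun x ↦ prolateSchwartz lam θ x * χ x) := by
        filter_upwards [hG.coeFn_toLp] with x hx
        rw [hx]
        by_cases hmem : x ∈ Ioo a b
        · rw [indicator_of_mem hmem, indicator_of_mem hmem]
        · rw [indicator_of_notMem hmem, indicator_of_notMem hmem, mul_zero]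
      rw [integral_congr_ae e1, MeasureTheory.integral_indicator measurableSet_Ioo,
        ← integral_Ioc_eq_integral_Ioo, intervalIntegral.integral_of_le hab.le]
    have h2 : ∫ x, θ x * (hH.toLp _ : L2R) x = ∫ x in a..b, θ x * Wχ x := by
      have e1 : (fun x ↦ θ x * (hH.toLp _ : L2R) x) =ᵐ[volume]
          (Ioo a b).indicator (fun x ↦ θ x * Wχ x) := by
        filter_upwards [hH.coeFn_toLp] with x hx
        rw [hx]
        by_cases hmem : x ∈ Ioo a b
        · rw [indicator_of_mem hmem, indicator_of_mem hmem]
        · rw [indicator_of_notMem hmem, indicator_of_notMem hmem, mul_zero]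
      rw [integral_congr_ae e1, MeasureTheory.integral_indicator measurableSet_Ioo,
        ← integral_Ioc_eq_integral_Ioo, intervalIntegral.integral_of_le hab.le]
    -- Green on `[a, b]`
    have hF : ∀ s ∈ Icc a b, pCoeff lam s * deriv χ s - pCoeff lam a * deriv χ a =
        ∫ t in a..s, deriv u t := by
      intro s _
      rw [intervalIntegral.integral_deriv_eq_sub (fun t _ ↦ (hud t).differentiableAt)
        (hu'c.intervalIntegrable _ _)]
    have hGreen := intervalIntegral_green_of_contDiffOn lam hab.le isOpen_univ (subset_univ _) hθ2
      hχ1.contDiffOn hF (hu'c.intervalIntegrable _ _)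
    have hi1 : IntervalIntegrable (fun x ↦ prolateSchwartz lam θ x * χ x) volume a b :=
      ((prolateSchwartz lam θ).continuous.mul hχ.continuous).intervalIntegrable _ _
    have hi2 : IntervalIntegrable (fun x ↦ θ x * Wχ x) volume a b :=
      (θ.continuous.mul hWχc).intervalIntegrable _ _
    rw [h1, h2, ← sub_eq_zero, ← intervalIntegral.integral_sub hi1 hi2]
    have e : ∀ t ∈ uIcc a b, prolateSchwartz lam θ t * χ t - θ t * Wχ t =
        (-deriv (fun s ↦ pCoeff lam s * deriv θ s) t + qCoeff lam t * θ t) * χ t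
          - θ t * (qCoeff lam t * χ t - deriv u t) := by
      intro t _
      simp only [hWχ, hu, prolateSchwartz_apply']
      ring
    rw [intervalIntegral.integral_congr e, hGreen]
    have eb : θ b * (pCoeff lam b * deriv χ b) - pCoeff lam b * deriv θ b * χ b = 0 := by
      rw [hb.2, mul_zero, zero_sub, neg_eq_zero, mul_right_comm, hb.1, zero_mul]
    have ea : θ a * (pCoeff lam a * deriv χ a) - pCoeff lam a * deriv θ a * χ a = 0 := by
      rw [ha.2, mul_zero, zero_sub, neg_eq_zero, mul_right_comm, ha.1, zero_mul]
    rw [eb, ea, sub_zero]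
  exact exists_prolateMax_eq_of_forall_integral lam hweak

end TestElement

/-! ## §2. One-sided limits of `p g′` at a singular point vanish under symmetry against test elements -/

section OneSided

/-- Shared bump data at `a` of radii `r/4 < r/2`: the complexified bump `χ`, smooth, `= 1` on
`[a − r/4, a + r/4]`, `= 0` off `(a − r/2, a + r/2)`, with `χ′ = 0` on both regions. [folklore] -/
private theorem exists_bump (a : ℝ) {r : ℝ} (hr : 0 < r) :
    ∃ χ : ℝ → ℂ, ContDiff ℝ 2 χ ∧ (∀ x, dist x a ≤ r / 4 → χ x = 1) ∧
      (∀ x, r / 2 ≤ dist x a → χ x = 0) ∧ (∀ x, dist x a < r / 4 → deriv χ x = 0) ∧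
      (∀ x, r / 2 < dist x a → deriv χ x = 0) ∧ (∀ x, ‖χ x‖ ≤ 1) := by
  let φ : ContDiffBump a := ⟨r / 4, r / 2, by positivity, by linarith⟩
  refine ⟨fun x ↦ ((φ x : ℝ) : ℂ), Complex.ofRealCLM.contDiff.comp φ.contDiff, ?_, ?_, ?_, ?_, ?_⟩
  · intro x hx
    show ((φ x : ℝ) : ℂ) = 1
    rw [φ.one_of_mem_closedBall (by simpa [mem_closedBall] using hx)]; simp
  · intro x hx
    show ((φ x : ℝ) : ℂ) = 0
    rw [φ.zero_of_le_dist (by simpa using hx)]; simp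
  · intro x hx
    have hev : (fun y ↦ ((φ y : ℝ) : ℂ)) =ᶠ[𝓝 x] fun _ ↦ (1 : ℂ) := by
      have hball : ball a (r / 4) ∈ 𝓝 x := isOpen_ball.mem_nhds (by simpa [mem_ball] using hx)
      filter_upwards [hball] with y hy
      rw [φ.one_of_mem_closedBall (ball_subset_closedBall hy)]; simp
    rw [hev.deriv_eq, deriv_const]
  · intro x hx
    have hev : (fun y ↦ ((φ y : ℝ) : ℂ)) =ᶠ[𝓝 x] fun _ ↦ (0 : ℂ) := by
      have hopen : IsOpen {y : ℝ | r / 2 < dist y a} := isOpen_lt continuous_const (continuous_id.dist continuous_const)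
      filter_upwards [hopen.mem_nhds (by simpa using hx)] with y hy
      rw [φ.zero_of_le_dist (le_of_lt hy)]; simp
    rw [hev.deriv_eq, deriv_const]
  · intro x
    rw [Complex.norm_real, Real.norm_eq_abs, abs_of_nonneg φ.nonneg]
    exact φ.le_one

variable (hlam : 0 < lam)
include hlam

/-- **Engine (right side).**  Let `ξ ∈ dom W_max` with regular representative `g` (the FTC form of
`exists_regular_repr`), and suppose `ξ` is `W_max`-symmetric against every `ζ ∈ dom W_max`:
`⟪W_max ξ, ζ⟫ = ⟪ξ, W_max ζ⟫` (e.g. `ξ ∈ dom W_min = dom (W_max)†`).  If `a` is a singular point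
(`p(a) = 0`) and `(a, a + r] ⊂ ℝ ∖ {±λ}`, then `p g′ → 0` as `x → a⁺`.
Proof: test `ξ` against `ζ = 1_{(a, a+r)} χ` (`χ` a bump, `= 1` near `a`): symmetry gives
`∫_a^{a+r} (conj η·χ − conj g·Wχ) = 0`, Lagrange's identity on `[s, a + r]` evaluates
`∫_s^{a+r} (…) = conj (p g′)(s)` for `s` near `a`, and the left side is continuous in `s`.
("`L` vanishes on `Dom W_min`": the one-sided version of Lemma 1.2 (iv), here obtained from
(1.4)–(1.6).) [cite: ConnesMoscovici2022, Lemma 1.2 (iv)–(v) and proof of Lemma 1.3 (= arXiv:2112.05500 Lemma 2.2, chunk p0004:L88–L99; Lemma 2.3, p0004:L110–L120)] -/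
theorem tendsto_pDeriv_nhdsGT_zero_of_inner_symm {a r : ℝ} (ha : pCoeff lam a = 0) (hr : 0 < r)
    (hJS : Ioc a (a + r) ⊆ {x : ℝ | x ≠ lam ∧ x ≠ -lam})
    (ξ : (prolateMax lam).domain) {g : ℝ → ℂ} (hae : ((ξ : L2R) : ℝ → ℂ) =ᵐ[volume] g)
    (hg : ContDiffOn ℝ 1 g {x | x ≠ lam ∧ x ≠ -lam})
    (hftc : ∀ x y, x ≤ y → Icc x y ⊆ {x | x ≠ lam ∧ x ≠ -lam} →
      pCoeff lam y * deriv g y - pCoeff lam x * deriv g x =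
        ∫ t in x..y, (qCoeff lam t * g t - (prolateMax lam ξ : L2R) t))
    (hsym : ∀ ζ : (prolateMax lam).domain,
      ⟪(prolateMax lam ξ : L2R), (ζ : L2R)⟫_ℂ = ⟪(ξ : L2R), (prolateMax lam ζ : L2R)⟫_ℂ) :
    Tendsto (fun x ↦ pCoeff lam x * deriv g x) (𝓝[>] a) (𝓝 0) := by
  have _ := hlam
  set S : Set ℝ := {x | x ≠ lam ∧ x ≠ -lam} with hS
  set b : ℝ := a + r with hb
  have hab : a < b := by rw [hb]; linarith
  set η : ℝ → ℂ := fun t ↦ ((prolateMax lam ξ : L2R) : ℝ → ℂ) t with hη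
  -- the bump `χ` at `a` and its classical image `Wχ`
  obtain ⟨χ, hχ, hχ1, hχ0, hχ'1, hχ'0, hχle⟩ := exists_bump a hr
  have h2 : ContDiff ℝ (1 + 1) χ := by simpa [one_add_one_eq_two] using hχ
  have hχd : Differentiable ℝ χ := (contDiff_succ_iff_deriv.mp h2).1
  have hχ'c1 : ContDiff ℝ 1 (deriv χ) := (contDiff_succ_iff_deriv.mp h2).2.2
  have hχ'd : Differentiable ℝ (deriv χ) := hχ'c1.differentiable one_ne_zero
  have hχ''c : Continuous (deriv (deriv χ)) := hχ'c1.continuous_deriv le_rfl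
  have hχ1' : ContDiff ℝ 1 χ := hχ.of_le (by norm_num)
  set u : ℝ → ℂ := fun s ↦ pCoeff lam s * deriv χ s with hu
  have hud : ∀ s, HasDerivAt u
      (((-(2 * s) : ℝ) : ℂ) * deriv χ s + pCoeff lam s * deriv (deriv χ) s) s := fun s ↦
    (hasDerivAt_pCoeff₃ lam s).mul (hχ'd s).hasDerivAt
  have hu' : deriv u = fun s ↦ ((-(2 * s) : ℝ) : ℂ) * deriv χ s + pCoeff lam s * deriv (deriv χ) s :=
    funext fun s ↦ (hud s).deriv
  have hu'c : Continuous (deriv u) := by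
    rw [hu']
    exact ((Complex.continuous_ofReal.comp (by fun_prop)).mul hχ'c1.continuous).add
      ((continuous_pCoeff₃ lam).mul hχ''c)
  set Wχ : ℝ → ℂ := fun t ↦ -deriv (fun s ↦ pCoeff lam s * deriv χ s) t + qCoeff lam t * χ t
    with hWχ
  have hWχc : Continuous Wχ := hu'c.neg.add ((continuous_qCoeff₃ lam).mul hχ.continuous)
  -- endpoint data: `χ(b) = χ′(b) = 0`
  have hbd : dist b a = r := by rw [hb, Real.dist_eq]; simp [abs_of_pos hr]
  have hχb : χ b = 0 := hχ0 b (by rw [hbd]; linarith)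
  have hχ'b : deriv χ b = 0 := hχ'0 b (by rw [hbd]; linarith)
  -- the test element `ζ = [1_{(a,b)} χ]`, `W_max ζ = [1_{(a,b)} Wχ]`
  obtain ⟨hGm, hHm, hdom, hWζ⟩ := indicator_mem_prolateMax lam hab hχ
    ⟨by rw [ha, zero_mul], by rw [ha, zero_mul]⟩ ⟨by rw [hχb, mul_zero], by rw [hχ'b, mul_zero]⟩
  set ζ : (prolateMax lam).domain := ⟨hGm.toLp _, hdom⟩ with hζ
  have hζae : ((ζ : L2R) : ℝ → ℂ) =ᵐ[volume] (Ioo a b).indicator χ := hGm.coeFn_toLp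
  have hWζae : ((prolateMax lam ζ : L2R) : ℝ → ℂ) =ᵐ[volume] (Ioo a b).indicator Wχ := by
    rw [hWζ]; exact hHm.coeFn_toLp
  -- symmetry ⟹ `∫_a^b F = 0`, `F = conj η · χ − conj g · Wχ`
  set F : ℝ → ℂ := fun t ↦ star (η t) * χ t - star (g t) * Wχ t with hF
  have hint0 : ∫ t, (star (η t) * (Ioo a b).indicator χ t -
      star (g t) * ((prolateMax lam ζ : L2R) : ℝ → ℂ) t) = 0 := by
    rw [integral_F_eq_inner_sub (η₁ := (prolateMax lam ξ : L2R)) (η₂ := (prolateMax lam ζ : L2R))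
      hae hζae, hsym ζ, sub_self]
  have hIab : ∫ t in a..b, F t = 0 := by
    have e1 : (fun t ↦ star (η t) * (Ioo a b).indicator χ t -
        star (g t) * ((prolateMax lam ζ : L2R) : ℝ → ℂ) t) =ᵐ[volume] (Ioo a b).indicator F := by
      filter_upwards [hWζae] with t ht
      rw [ht]
      by_cases hmem : t ∈ Ioo a b
      · simp only [indicator_of_mem hmem, hF]
      · simp only [indicator_of_notMem hmem, mul_zero, sub_zero]
    rw [integral_congr_ae e1, MeasureTheory.integral_indicator measurableSet_Ioo,
      ← integral_Ioc_eq_integral_Ioo, ← intervalIntegral.integral_of_le hab.le] at hint0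
    exact hint0
  -- integrability of `F` on bounded intervals
  have hηi : ∀ x y, IntervalIntegrable η volume x y := fun x y ↦
    (((Lp.memLp (prolateMax lam ξ : L2R)).locallyIntegrable (by norm_num)).integrableOn_isCompact
      isCompact_uIcc).intervalIntegrable
  have hgi : ∀ x y, IntervalIntegrable g volume x y := intervalIntegrable_repr₃ (ξ : L2R) hae
  have hFi : ∀ x y, IntervalIntegrable F volume x y := fun x y ↦
    ((intervalIntegrable_star₃ (hηi x y)).mul_continuousOn hχ.continuous.continuousOn).sub
      ((intervalIntegrable_star₃ (hgi x y)).mul_continuousOn hWχc.continuousOn)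
  -- Lagrange on `[s, b] ⊂ (a, b]`: `∫_s^b F = conj (p g′)(s)` for `s ∈ (a, a + r/4)`
  have hWχm : MemLp Wχ 2 volume := by
    refine hWχc.memLp_of_hasCompactSupport ?_
    refine HasCompactSupport.of_support_subset_isCompact (isCompact_closedBall a (r / 2)) ?_
    intro t ht
    rw [mem_closedBall]
    by_contra hlt
    rw [not_le] at hlt
    apply ht
    have h0 : χ t = 0 := hχ0 t hlt.le
    have hd0 : deriv (fun s ↦ pCoeff lam s * deriv χ s) t = 0 := by
      have hev : (fun s ↦ pCoeff lam s * deriv χ s) =ᶠ[𝓝 t] fun _ ↦ (0 : ℂ) := by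
        have hopen : IsOpen {y : ℝ | r / 2 < dist y a} :=
          isOpen_lt continuous_const (continuous_id.dist continuous_const)
        filter_upwards [hopen.mem_nhds (by simpa using hlt)] with y hy
        rw [hχ'0 y hy, mul_zero]
      rw [hev.deriv_eq, deriv_const]
    simp only [hWχ, hd0, h0, neg_zero, mul_zero, add_zero]
  set ηχ : L2R := hWχm.toLp Wχ with hηχ
  have hηχae : ((ηχ : L2R) : ℝ → ℂ) =ᵐ[volume] Wχ := hWχm.coeFn_toLp
  have hftcχ : ∀ x y, x ≤ y → Icc x y ⊆ S →
      pCoeff lam y * deriv χ y - pCoeff lam x * deriv χ x =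
        ∫ t in x..y, (qCoeff lam t * χ t - (ηχ : ℝ → ℂ) t) := by
    intro x y _ _
    have e1 : ∫ t in x..y, (qCoeff lam t * χ t - (ηχ : ℝ → ℂ) t) = ∫ t in x..y, deriv u t := by
      refine intervalIntegral.integral_congr_ae ?_
      filter_upwards [hηχae] with t ht _
      rw [ht]
      simp only [hWχ, hu]
      ring
    rw [e1, intervalIntegral.integral_deriv_eq_sub (fun t _ ↦ (hud t).differentiableAt)
      (hu'c.intervalIntegrable _ _)]
  have hLag : ∀ s, a < s → s < a + r / 4 →
      ∫ t in s..b, F t = star (pCoeff lam s * deriv g s) := by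
    intro s has hsr
    have hsb : s ≤ b := by rw [hb]; linarith
    have hI : Icc s b ⊆ S := fun t ht ↦ hJS ⟨has.trans_le ht.1, ht.2⟩
    have hL := intervalIntegral_lagrange_pair (η₁ := (prolateMax lam ξ : L2R)) (η₂ := ηχ)
      hg hftc hχ1'.contDiffOn hftcχ hsb hI
    have e1 : ∫ t in s..b, F t =
        ∫ t in s..b, (star (η t) * χ t - star (g t) * (ηχ : ℝ → ℂ) t) := by
      refine intervalIntegral.integral_congr_ae ?_
      filter_upwards [hηχae] with t ht _
      rw [hF, ht]
    have hds : dist s a < r / 4 := by rw [Real.dist_eq, abs_of_pos (by linarith)]; linarith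
    rw [e1, hL, hχb, hχ'b, hχ1 s hds.le, hχ'1 s hds]
    simp
  -- continuity of `s ↦ ∫_s^b F` at `a⁺`, with value `0` at `s = a`
  have hcont : Tendsto (fun s ↦ ∫ t in s..b, F t) (𝓝[>] a) (𝓝 0) := by
    have hc : ContinuousOn (fun s ↦ ∫ t in s..b, F t) (uIcc a b) :=
      intervalIntegral.continuousOn_primitive_interval_left ((intervalIntegrable_iff').1 (hFi a b))
    have h1 := (hc a left_mem_uIcc).tendsto
    rw [hIab] at h1
    refine h1.mono_left ?_
    rw [uIcc_of_le hab.le, ← nhdsWithin_Ioo_eq_nhdsGT hab]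
    exact nhdsWithin_mono _ Ioo_subset_Icc_self
  -- conclude
  have hev : ∀ᶠ s in 𝓝[>] a, star (∫ t in s..b, F t) = pCoeff lam s * deriv g s := by
    filter_upwards [Ioo_mem_nhdsGT (show a < a + r / 4 by linarith)] with s hs
    rw [hLag s hs.1 hs.2, star_star]
  have h2 := (continuous_star.tendsto (0 : ℂ)).comp hcont
  rw [star_zero] at h2
  exact h2.congr' hev

/-- **Engine (left side)**: the mirror statement, `p g′ → 0` as `x → a⁻` when `[a − r, a) ⊂ ℝ ∖ {±λ}`.
[cite: ConnesMoscovici2022, Lemma 1.2 (iv)–(v) and proof of Lemma 1.3 (= arXiv:2112.05500 Lemma 2.2, chunk p0004:L88–L99; Lemma 2.3, p0004:L110–L120)] -/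
theorem tendsto_pDeriv_nhdsLT_zero_of_inner_symm {a r : ℝ} (ha : pCoeff lam a = 0) (hr : 0 < r)
    (hJS : Ico (a - r) a ⊆ {x : ℝ | x ≠ lam ∧ x ≠ -lam})
    (ξ : (prolateMax lam).domain) {g : ℝ → ℂ} (hae : ((ξ : L2R) : ℝ → ℂ) =ᵐ[volume] g)
    (hg : ContDiffOn ℝ 1 g {x | x ≠ lam ∧ x ≠ -lam})
    (hftc : ∀ x y, x ≤ y → Icc x y ⊆ {x | x ≠ lam ∧ x ≠ -lam} →
      pCoeff lam y * deriv g y - pCoeff lam x * deriv g x =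
        ∫ t in x..y, (qCoeff lam t * g t - (prolateMax lam ξ : L2R) t))
    (hsym : ∀ ζ : (prolateMax lam).domain,
      ⟪(prolateMax lam ξ : L2R), (ζ : L2R)⟫_ℂ = ⟪(ξ : L2R), (prolateMax lam ζ : L2R)⟫_ℂ) :
    Tendsto (fun x ↦ pCoeff lam x * deriv g x) (𝓝[<] a) (𝓝 0) := by
  have _ := hlam
  set S : Set ℝ := {x | x ≠ lam ∧ x ≠ -lam} with hS
  set b : ℝ := a - r with hb
  have hba : b < a := by rw [hb]; linarith
  set η : ℝ → ℂ := fun t ↦ ((prolateMax lam ξ : L2R) : ℝ → ℂ) t with hη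
  obtain ⟨χ, hχ, hχ1, hχ0, hχ'1, hχ'0, hχle⟩ := exists_bump a hr
  have h2 : ContDiff ℝ (1 + 1) χ := by simpa [one_add_one_eq_two] using hχ
  have hχd : Differentiable ℝ χ := (contDiff_succ_iff_deriv.mp h2).1
  have hχ'c1 : ContDiff ℝ 1 (deriv χ) := (contDiff_succ_iff_deriv.mp h2).2.2
  have hχ'd : Differentiable ℝ (deriv χ) := hχ'c1.differentiable one_ne_zero
  have hχ''c : Continuous (deriv (deriv χ)) := hχ'c1.continuous_deriv le_rfl
  have hχ1' : ContDiff ℝ 1 χ := hχ.of_le (by norm_num)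
  set u : ℝ → ℂ := fun s ↦ pCoeff lam s * deriv χ s with hu
  have hud : ∀ s, HasDerivAt u
      (((-(2 * s) : ℝ) : ℂ) * deriv χ s + pCoeff lam s * deriv (deriv χ) s) s := fun s ↦
    (hasDerivAt_pCoeff₃ lam s).mul (hχ'd s).hasDerivAt
  have hu' : deriv u = fun s ↦ ((-(2 * s) : ℝ) : ℂ) * deriv χ s + pCoeff lam s * deriv (deriv χ) s :=
    funext fun s ↦ (hud s).deriv
  have hu'c : Continuous (deriv u) := by
    rw [hu']
    exact ((Complex.continuous_ofReal.comp (by fun_prop)).mul hχ'c1.continuous).add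
      ((continuous_pCoeff₃ lam).mul hχ''c)
  set Wχ : ℝ → ℂ := fun t ↦ -deriv (fun s ↦ pCoeff lam s * deriv χ s) t + qCoeff lam t * χ t
    with hWχ
  have hWχc : Continuous Wχ := hu'c.neg.add ((continuous_qCoeff₃ lam).mul hχ.continuous)
  have hbd : dist b a = r := by rw [hb, Real.dist_eq]; simp [abs_of_pos hr]
  have hχb : χ b = 0 := hχ0 b (by rw [hbd]; linarith)
  have hχ'b : deriv χ b = 0 := hχ'0 b (by rw [hbd]; linarith)
  obtain ⟨hGm, hHm, hdom, hWζ⟩ := indicator_mem_prolateMax lam hba hχ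
    ⟨by rw [hχb, mul_zero], by rw [hχ'b, mul_zero]⟩ ⟨by rw [ha, zero_mul], by rw [ha, zero_mul]⟩
  set ζ : (prolateMax lam).domain := ⟨hGm.toLp _, hdom⟩ with hζ
  have hζae : ((ζ : L2R) : ℝ → ℂ) =ᵐ[volume] (Ioo b a).indicator χ := hGm.coeFn_toLp
  have hWζae : ((prolateMax lam ζ : L2R) : ℝ → ℂ) =ᵐ[volume] (Ioo b a).indicator Wχ := by
    rw [hWζ]; exact hHm.coeFn_toLp
  set F : ℝ → ℂ := fun t ↦ star (η t) * χ t - star (g t) * Wχ t with hF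
  have hint0 : ∫ t, (star (η t) * (Ioo b a).indicator χ t -
      star (g t) * ((prolateMax lam ζ : L2R) : ℝ → ℂ) t) = 0 := by
    rw [integral_F_eq_inner_sub (η₁ := (prolateMax lam ξ : L2R)) (η₂ := (prolateMax lam ζ : L2R))
      hae hζae, hsym ζ, sub_self]
  have hIba : ∫ t in b..a, F t = 0 := by
    have e1 : (fun t ↦ star (η t) * (Ioo b a).indicator χ t -
        star (g t) * ((prolateMax lam ζ : L2R) : ℝ → ℂ) t) =ᵐ[volume] (Ioo b a).indicator F := by
      filter_upwards [hWζae] with t ht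
      rw [ht]
      by_cases hmem : t ∈ Ioo b a
      · simp only [indicator_of_mem hmem, hF]
      · simp only [indicator_of_notMem hmem, mul_zero, sub_zero]
    rw [integral_congr_ae e1, MeasureTheory.integral_indicator measurableSet_Ioo,
      ← integral_Ioc_eq_integral_Ioo, ← intervalIntegral.integral_of_le hba.le] at hint0
    exact hint0
  have hηi : ∀ x y, IntervalIntegrable η volume x y := fun x y ↦
    (((Lp.memLp (prolateMax lam ξ : L2R)).locallyIntegrable (by norm_num)).integrableOn_isCompact
      isCompact_uIcc).intervalIntegrable
  have hgi : ∀ x y, IntervalIntegrable g volume x y := intervalIntegrable_repr₃ (ξ : L2R) hae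
  have hFi : ∀ x y, IntervalIntegrable F volume x y := fun x y ↦
    ((intervalIntegrable_star₃ (hηi x y)).mul_continuousOn hχ.continuous.continuousOn).sub
      ((intervalIntegrable_star₃ (hgi x y)).mul_continuousOn hWχc.continuousOn)
  have hWχm : MemLp Wχ 2 volume := by
    refine hWχc.memLp_of_hasCompactSupport ?_
    refine HasCompactSupport.of_support_subset_isCompact (isCompact_closedBall a (r / 2)) ?_
    intro t ht
    rw [mem_closedBall]
    by_contra hlt
    rw [not_le] at hlt
    apply ht
    have h0 : χ t = 0 := hχ0 t hlt.le
    have hd0 : deriv (fun s ↦ pCoeff lam s * deriv χ s) t = 0 := by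
      have hev : (fun s ↦ pCoeff lam s * deriv χ s) =ᶠ[𝓝 t] fun _ ↦ (0 : ℂ) := by
        have hopen : IsOpen {y : ℝ | r / 2 < dist y a} :=
          isOpen_lt continuous_const (continuous_id.dist continuous_const)
        filter_upwards [hopen.mem_nhds (by simpa using hlt)] with y hy
        rw [hχ'0 y hy, mul_zero]
      rw [hev.deriv_eq, deriv_const]
    simp only [hWχ, hd0, h0, neg_zero, mul_zero, add_zero]
  set ηχ : L2R := hWχm.toLp Wχ with hηχ
  have hηχae : ((ηχ : L2R) : ℝ → ℂ) =ᵐ[volume] Wχ := hWχm.coeFn_toLp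
  have hftcχ : ∀ x y, x ≤ y → Icc x y ⊆ S →
      pCoeff lam y * deriv χ y - pCoeff lam x * deriv χ x =
        ∫ t in x..y, (qCoeff lam t * χ t - (ηχ : ℝ → ℂ) t) := by
    intro x y _ _
    have e1 : ∫ t in x..y, (qCoeff lam t * χ t - (ηχ : ℝ → ℂ) t) = ∫ t in x..y, deriv u t := by
      refine intervalIntegral.integral_congr_ae ?_
      filter_upwards [hηχae] with t ht _
      rw [ht]
      simp only [hWχ, hu]
      ring
    rw [e1, intervalIntegral.integral_deriv_eq_sub (fun t _ ↦ (hud t).differentiableAt)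
      (hu'c.intervalIntegrable _ _)]
  -- Lagrange on `[b, s] ⊂ [b, a)`: `∫_b^s F = −conj (p g′)(s)` for `s ∈ (a − r/4, a)`
  have hLag : ∀ s, a - r / 4 < s → s < a →
      ∫ t in b..s, F t = -star (pCoeff lam s * deriv g s) := by
    intro s hsr hsa
    have hbs : b ≤ s := by rw [hb]; linarith
    have hI : Icc b s ⊆ S := fun t ht ↦ hJS ⟨ht.1, ht.2.trans_lt hsa⟩
    have hL := intervalIntegral_lagrange_pair (η₁ := (prolateMax lam ξ : L2R)) (η₂ := ηχ)
      hg hftc hχ1'.contDiffOn hftcχ hbs hI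
    have e1 : ∫ t in b..s, F t =
        ∫ t in b..s, (star (η t) * χ t - star (g t) * (ηχ : ℝ → ℂ) t) := by
      refine intervalIntegral.integral_congr_ae ?_
      filter_upwards [hηχae] with t ht _
      rw [hF, ht]
    have hds : dist s a < r / 4 := by rw [Real.dist_eq, abs_of_neg (by linarith)]; linarith
    rw [e1, hL, hχb, hχ'b, hχ1 s hds.le, hχ'1 s hds]
    simp
  have hcont : Tendsto (fun s ↦ ∫ t in b..s, F t) (𝓝[<] a) (𝓝 0) := by
    have hc : ContinuousOn (fun s ↦ ∫ t in b..s, F t) (uIcc b a) :=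
      intervalIntegral.continuousOn_primitive_interval ((intervalIntegrable_iff').1 (hFi b a))
    have h1 := (hc a right_mem_uIcc).tendsto
    rw [hIba] at h1
    refine h1.mono_left ?_
    rw [uIcc_of_le hba.le, ← nhdsWithin_Ioo_eq_nhdsLT hba]
    exact nhdsWithin_mono _ Ioo_subset_Icc_self
  have hev : ∀ᶠ s in 𝓝[<] a, -star (∫ t in b..s, F t) = pCoeff lam s * deriv g s := by
    filter_upwards [Ioo_mem_nhdsLT (show a - r / 4 < a by linarith)] with s hs
    rw [hLag s hs.1 hs.2, star_neg, star_star, neg_neg]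
  have h2 := ((continuous_star.tendsto (0 : ℂ)).comp hcont).neg
  rw [star_zero, neg_zero] at h2
  exact h2.congr' hev

end OneSided

/-! ## §3. (1.19) for `dom W_min` -/

section MinDomain

variable (hlam : 0 < lam)
include hlam

/-- **(1.19) holds on `dom W_min`, one-sided form.**  For `ξ ∈ dom W_min` (the closure of `W_λ` on
`𝒮(ℝ)`) with regular representative `g`, ALL FOUR one-sided limits of `(λ² − x²) g′(x)` at `±λ`
vanish — because `dom W_min ⊆ dom (W_max)^*` makes `ξ` symmetric against the test elements of
§2 (`inner_prolateMax_comm_of_mem_prolateMin_left`).  This is the statement "`L` vanishes on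
`Dom W_min`" of Lemma 1.2 (iv), in the form needed for `dom W_min ⊆ 𝓛_β`.
[cite: ConnesMoscovici2022, Lemma 1.2 (iv) and the definition of `dom W_sa` before Thm 1.6 (= arXiv:2112.05500 Lemma 2.2, chunk p0004:L88–L99; (2.19), p0006:L62–L63)] -/
theorem tendsto_pDeriv_zero_of_mem_prolateMin (ξ : (prolateMax lam).domain)
    (hmin : (ξ : L2R) ∈ (prolateMin lam).domain) {g : ℝ → ℂ}
    (hae : ((ξ : L2R) : ℝ → ℂ) =ᵐ[volume] g) (hg : ContDiffOn ℝ 1 g {x | x ≠ lam ∧ x ≠ -lam})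
    (hftc : ∀ x y, x ≤ y → Icc x y ⊆ {x | x ≠ lam ∧ x ≠ -lam} →
      pCoeff lam y * deriv g y - pCoeff lam x * deriv g x =
        ∫ t in x..y, (qCoeff lam t * g t - (prolateMax lam ξ : L2R) t)) :
    Tendsto (fun x ↦ pCoeff lam x * deriv g x) (𝓝[>] lam) (𝓝 0) ∧
      Tendsto (fun x ↦ pCoeff lam x * deriv g x) (𝓝[<] lam) (𝓝 0) ∧
      Tendsto (fun x ↦ pCoeff lam x * deriv g x) (𝓝[>] (-lam)) (𝓝 0) ∧
      Tendsto (fun x ↦ pCoeff lam x * deriv g x) (𝓝[<] (-lam)) (𝓝 0) := by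
  have hsym : ∀ ζ : (prolateMax lam).domain,
      ⟪(prolateMax lam ξ : L2R), (ζ : L2R)⟫_ℂ = ⟪(ξ : L2R), (prolateMax lam ζ : L2R)⟫_ℂ :=
    fun ζ ↦ inner_prolateMax_comm_of_mem_prolateMin_left ξ ζ hmin
  have hpl : pCoeff lam lam = 0 := by simp [pCoeff]
  have hpm : pCoeff lam (-lam) = 0 := by simp [pCoeff]
  refine ⟨?_, ?_, ?_, ?_⟩
  · refine tendsto_pDeriv_nhdsGT_zero_of_inner_symm hlam hpl hlam (r := lam) ?_ ξ hae hg hftc hsym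
    intro x hx; exact ⟨hx.1.ne', by linarith [hx.1]⟩
  · refine tendsto_pDeriv_nhdsLT_zero_of_inner_symm hlam hpl hlam (r := lam) ?_ ξ hae hg hftc hsym
    intro x hx; exact ⟨hx.2.ne, by linarith [hx.1]⟩
  · refine tendsto_pDeriv_nhdsGT_zero_of_inner_symm hlam hpm hlam (r := lam) ?_ ξ hae hg hftc hsym
    intro x hx; exact ⟨by linarith [hx.2], hx.1.ne'⟩
  · refine tendsto_pDeriv_nhdsLT_zero_of_inner_symm hlam hpm hlam (r := lam) ?_ ξ hae hg hftc hsym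
    intro x hx; exact ⟨by linarith [hx.2], hx.2.ne⟩

/-- **(1.19) on `dom W_min`, in the `ProlateBC` form**: for `ξ ∈ dom W_min` with regular
representative `g`, `(λ² − x²) g′(x) → 0` as `x → ±λ` within `ℝ ∖ {±λ}` (the filters used by
`ProlateBC.atLam` / `ProlateBC.atNegLam`).
[cite: ConnesMoscovici2022, Lemma 1.2 (iv) and (2.19) (= arXiv:2112.05500 Lemma 2.2, chunk p0004:L88–L99; p0006:L62–L63)] -/
theorem tendsto_pDeriv_nhdsWithin_zero_of_mem_prolateMin (ξ : (prolateMax lam).domain)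
    (hmin : (ξ : L2R) ∈ (prolateMin lam).domain) {g : ℝ → ℂ}
    (hae : ((ξ : L2R) : ℝ → ℂ) =ᵐ[volume] g) (hg : ContDiffOn ℝ 1 g {x | x ≠ lam ∧ x ≠ -lam})
    (hftc : ∀ x y, x ≤ y → Icc x y ⊆ {x | x ≠ lam ∧ x ≠ -lam} →
      pCoeff lam y * deriv g y - pCoeff lam x * deriv g x =
        ∫ t in x..y, (qCoeff lam t * g t - (prolateMax lam ξ : L2R) t)) :
    Tendsto (fun x ↦ pCoeff lam x * deriv g x) (𝓝[{x : ℝ | x ≠ lam ∧ x ≠ -lam}] lam) (𝓝 0) ∧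
      Tendsto (fun x ↦ pCoeff lam x * deriv g x) (𝓝[{x : ℝ | x ≠ lam ∧ x ≠ -lam}] (-lam))
        (𝓝 0) := by
  obtain ⟨h1, h2, h3, h4⟩ := tendsto_pDeriv_zero_of_mem_prolateMin hlam ξ hmin hae hg hftc
  have hS1 : {x : ℝ | x ≠ lam ∧ x ≠ -lam} ⊆ {lam}ᶜ := fun x hx ↦ mem_compl_singleton_iff.mpr hx.1
  have hS2 : {x : ℝ | x ≠ lam ∧ x ≠ -lam} ⊆ {-lam}ᶜ := fun x hx ↦ mem_compl_singleton_iff.mpr hx.2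
  refine ⟨?_, ?_⟩
  · have h := h2.sup h1
    rw [nhdsLT_sup_nhdsGT] at h
    exact h.mono_left (nhdsWithin_mono _ hS1)
  · have h := h4.sup h3
    rw [nhdsLT_sup_nhdsGT] at h
    exact h.mono_left (nhdsWithin_mono _ hS2)

end MinDomain

end Literature.NumberTheory.ConnesMoscovici2022

end
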